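import Summits.Ventures.PercRepro.C041ZoneOCubeHub
import Summits.Ventures.PercRepro.C041ZoneOCubeUnionFin

/-!
# (O-CUBE) ON HUB CORES FROM THE ZONE O-CUBE OF THE INDEXED ZONES (p6, gen 27; C-041.md §14 (c))

Setting of `C041ZoneOCubeHub` and `C041ZoneOCubeUnionFin`.  For a tail-free hub core `O` (with `c` a non-terminal,
distinct terminals joined by an edge): the cube states are the pairs (admissible zone-states of the indexed zones,
outside part) — `split` / `glueZones` of `C041ZoneSplitGlue` (`glueZones_split`, `cubeEquiv`); the weight
`3·[Good_a] + 3·[Good_b] − 2` of a valid cube state is the product weight `ocwPi'` of its zone-states with the per-zone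
predicates `ValidZone`, `G1Z` (a red `b`-edge at `REACH_Z`), `G2Z` (a red `a`-edge at `REACH_Z` on side `b`)
(`gdWeight_eq_ocwPi`), and each per-zone weighted sum is the ZONE O-CUBE sum of the zone with forced edges
(`sum_zone_ocw_eq_zoneOCubeF`).  Hence, by the UNION LEMMA over the indexed zones:

* **`oCube_nonneg_of_zoneOCube_hub`** — if every indexed zone of `O` satisfies the ZONE O-CUBE conjecture
  (`ZoneOCubeConjF (zoneFZ a b O Z) (zoneA) (zoneQ)`), then `0 ≤ oCube a b c O`: (O-CUBE) for hub cores follows from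
  the ZONE O-CUBE of their zones — mine-3's gluing of C-041.md §14 (c) in the tree.
-/

namespace PercRepro

namespace MultiGraph

open Finset ZoneZ ZoneZ.ZoneData ZoneOCube

variable {V E : Type*} {G : MultiGraph V E} {a b c : V}

section PerZone

variable [Fintype V] (a b c) (O : Config E) (Z : Finset V)

/-- `G1` per zone: a red `b`-edge at a vertex of `REACH_Z` of the extension. -/
def G1Z (x : G.ZoneState a b Z) : Prop :=
  ∃ w, G.ReachZone a b c O (G.extZone a b O Z x) Z w ∧ ∃ e, G.Joins e w b ∧ G.extZone a b O Z x e = true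

/-- `G2` per zone: a red `a`-edge at a vertex of `REACH_Z` on side `b` of the extension. -/
def G2Z (x : G.ZoneState a b Z) : Prop :=
  ∃ w, G.ReachZoneB a b c O (G.extZone a b O Z x) Z w ∧ ∃ e, G.Joins e w a ∧ G.extZone a b O Z x e = true

variable {a b c O Z}

omit [Fintype V] in
/-- A vertex of `REACH_Z` lies in `K_Z`. -/
theorem kZone_of_reachZone {S : Config E} {w : V} (h : G.ReachZone a b c O S Z w) : G.KZone a b c O S Z w := by
  obtain ⟨w₀, hw₀, hK, _, hwalk⟩ := h
  exact ⟨w₀, hw₀, hK, redIn_walk_of_avoiding a b hwalk⟩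

omit [Fintype V] in
/-- A vertex of `REACH_Z` on side `b` lies in `K_Z`. -/
theorem kZone_of_reachZoneB {S : Config E} {w : V} (h : G.ReachZoneB a b c O S Z w) : G.KZone a b c O S Z w := by
  obtain ⟨w₀, hw₀, hK, _, hwalk⟩ := h
  exact ⟨w₀, hw₀, hK, redIn_walk_of_avoiding a b hwalk⟩

omit [Fintype V] in
/-- `G1Z` implies `ValidZone`. -/
theorem validZone_of_G1Z {x : G.ZoneState a b Z} (h : G.G1Z a b c O Z x) : G.ValidZone a b c O Z x := by
  obtain ⟨w, hw, e, hj, hSe⟩ := h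
  exact ⟨w, kZone_of_reachZone hw, e, hSe, Or.inr hj⟩

omit [Fintype V] in
/-- `G2Z` implies `ValidZone`. -/
theorem validZone_of_G2Z {x : G.ZoneState a b Z} (h : G.G2Z a b c O Z x) : G.ValidZone a b c O Z x := by
  obtain ⟨w, hw, e, hj, hSe⟩ := h
  exact ⟨w, kZone_of_reachZoneB hw, e, hSe, Or.inl hj⟩

omit [Fintype V] in
/-- The weight of a valid state as an `ocw`. -/
theorem gdWeight_eq_ocw {S : Config E} (hvalid : ¬ G.RcInvalid a b c S) :
    G.gdWeight a b c S =
      ocw (fun S => ¬ G.RcInvalid a b c S) (fun S => G.WalkAvoiding S (G.cluster Sᶜ a) c b)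
        (fun S => G.WalkAvoiding S (G.cluster Sᶜ b) c a) S := by
  unfold gdWeight ocw
  rw [ind_of_true hvalid]
  by_cases h1 : G.WalkAvoiding S (G.cluster Sᶜ a) c b <;> by_cases h2 : G.WalkAvoiding S (G.cluster Sᶜ b) c a
  · rw [if_pos h1, if_pos h2, ind_of_true h1, ind_of_true h2]
    ring
  · rw [if_pos h1, if_neg h2, ind_of_true h1, ind_of_false h2]
    ring
  · rw [if_neg h1, if_pos h2, ind_of_false h1, ind_of_true h2]
    ring
  · rw [if_neg h1, if_neg h2, ind_of_false h1, ind_of_false h2]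
    ring

end PerZone

section Weights

variable [Fintype V] [Fintype E] [DecidableEq E] (hc : c ≠ a ∧ c ≠ b) (hne : a ≠ b) (hab : ∃ e, G.Joins e a b)
  {O : Config E}

include hc hne hab

/-- **The weight of a cube state on a tail-free hub core is the product weight of its zone-states.** -/
theorem gdWeight_eq_ocwPi (hO : G.TailFree a b c O) (hhub : G.HubCore a b c O) {S : Config E}
    (hS : G.IsCubeState a b c O S) :
    ocw (fun S => ¬ G.RcInvalid a b c S) (fun S => G.WalkAvoiding S (G.cluster Sᶜ a) c b)
        (fun S => G.WalkAvoiding S (G.cluster Sᶜ b) c a) S =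
      ocwPi' (S := fun Z : G.ZoneIdx a b c O => G.ZoneState a b Z.1) (fun Z => G.ValidZone a b c O Z.1)
        (fun Z => G.G1Z a b c O Z.1) (fun Z => G.G2Z a b c O Z.1) (fun Z => G.restrictZone a b Z.1 S) := by
  unfold ocwPi'
  refine ocw_eq_of_iff ?_ ?_ ?_
  · rw [valid_iff_exists_zone hc hab hO hS]
    constructor
    · rintro ⟨Z, w, hw, e, hSe, hj⟩
      have hZe : G.ZoneEdge a b Z.1 e := by
        rcases hj with hj | hj
        · exact zoneEdge_of_terminal (mem_of_kZone a b c hw) (Or.inl rfl) hj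
        · exact zoneEdge_of_terminal (mem_of_kZone a b c hw) (Or.inr rfl) hj
      refine ⟨Z, w, (kZone_restrict_iff a b c Z.1 w).2 hw, e, ?_, hj⟩
      rw [extZone_restrictZone_agree Z.1 S e hZe]
      exact hSe
    · rintro ⟨Z, w, hw, e, hSe, hj⟩
      have hw' := (kZone_restrict_iff a b c Z.1 w).1 hw
      have hZe : G.ZoneEdge a b Z.1 e := by
        rcases hj with hj | hj
        · exact zoneEdge_of_terminal (mem_of_kZone a b c hw') (Or.inl rfl) hj
        · exact zoneEdge_of_terminal (mem_of_kZone a b c hw') (Or.inr rfl) hj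
      refine ⟨Z, w, hw', e, ?_, hj⟩
      rw [extZone_restrictZone_agree Z.1 S e hZe] at hSe
      exact hSe
  · rw [goodA_iff_exists_zone hc hO hhub hS]
    constructor
    · rintro ⟨Z, w, hw, e, hj, hSe⟩
      refine ⟨Z, w, (reachZone_restrict_iff a b c hc hne hS Z.2 w).2 hw, e, hj, ?_⟩
      rw [extZone_restrictZone_agree Z.1 S e (zoneEdge_of_terminal (mem_of_reachZone a b c hw) (Or.inr rfl) hj)]
      exact hSe
    · rintro ⟨Z, w, hw, e, hj, hSe⟩
      refine ⟨Z, w, (reachZone_restrict_iff a b c hc hne hS Z.2 w).1 hw, e, hj, ?_⟩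
      rw [extZone_restrictZone_agree Z.1 S e (zoneEdge_of_terminal (mem_of_reachZone a b c hw) (Or.inr rfl) hj)]
        at hSe
      exact hSe
  · rw [goodB_iff_exists_zone hc hO hhub hS]
    constructor
    · rintro ⟨Z, w, hw, e, hj, hSe⟩
      refine ⟨Z, w, (reachZoneB_restrict_iff hc hne hS Z.2 w).2 hw, e, hj, ?_⟩
      rw [extZone_restrictZone_agree Z.1 S e (zoneEdge_of_terminal (mem_of_reachZoneB hw) (Or.inl rfl) hj)]
      exact hSe
    · rintro ⟨Z, w, hw, e, hj, hSe⟩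
      refine ⟨Z, w, (reachZoneB_restrict_iff hc hne hS Z.2 w).1 hw, e, hj, ?_⟩
      rw [extZone_restrictZone_agree Z.1 S e (zoneEdge_of_terminal (mem_of_reachZoneB hw) (Or.inl rfl) hj)]
        at hSe
      exact hSe

end Weights

section Sum

variable [Fintype V] [Fintype E] [DecidableEq E] (hc : c ≠ a ∧ c ≠ b) (hne : a ≠ b) {O : Config E}

/-- The admissible zone-states of an indexed zone, as a type. -/
abbrev AZ (O : Config E) (Z : G.ZoneIdx a b c O) : Type _ := {x : G.ZoneState a b Z.1 // G.AdmZone a b c O Z.1 x}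

include hc hne

omit [Fintype E] [DecidableEq E] hne in
/-- The gluing of the split of a cube state is the state. -/
theorem glueZones_split (S : G.CubeT a b c O) :
    G.glueZones a b c O (G.split a b c O S).1 (G.split a b c O S).2.1 = S.1 := by
  funext e
  by_cases h : ∃ Z : G.ZoneIdx a b c O, G.ZoneEdge a b Z.1 e
  · obtain ⟨Z, hZe⟩ := h
    rw [glueZones_of_zoneEdge hc _ _ Z hZe]
    rfl
  · rw [glueZones_of_outEdge _ _ h]
    rfl

omit [Fintype E] [DecidableEq E] in
/-- The cube states are the pairs (admissible zone-states, outside part). -/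
noncomputable def cubeEquiv : G.CubeT a b c O ≃ (∀ Z : G.ZoneIdx a b c O, G.AZ O Z) × G.OutT a b c O where
  toFun S := (fun Z => ⟨(G.split a b c O S).1 Z, admZone_restrict a b c hc hne S.2 Z.2⟩, (G.split a b c O S).2)
  invFun p := ⟨G.glueZones a b c O (fun Z => (p.1 Z).1) p.2.1, isCubeState_glueZones hc hne _ (fun Z => (p.1 Z).2) p.2⟩
  left_inv S := by
    apply Subtype.ext
    exact glueZones_split hc S
  right_inv p := by
    obtain ⟨x, t⟩ := p
    have h := split_glueZones hc hne (fun Z => (x Z).1) (fun Z => (x Z).2) t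
    have h1 : ∀ Z, (G.split a b c O ⟨G.glueZones a b c O (fun Z => (x Z).1) t.1,
        isCubeState_glueZones hc hne _ (fun Z => (x Z).2) t⟩).1 Z = (x Z).1 :=
      fun Z => congrFun (congrArg Prod.fst h) Z
    have h2 : (G.split a b c O ⟨G.glueZones a b c O (fun Z => (x Z).1) t.1,
        isCubeState_glueZones hc hne _ (fun Z => (x Z).2) t⟩).2 = t := congrArg Prod.snd h
    exact Prod.ext (funext fun Z => Subtype.ext (h1 Z)) h2

omit [Fintype E] [DecidableEq E] in
/-- The per-zone weight on an admissible zone-state is the weight of its abstract state. -/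
theorem ocw_eq_ocWeight_zone {Z : Finset V} (hZ : G.IsIdxZone a b c O Z) (x : G.ZoneState a b Z)
    (hx : G.AdmZone a b c O Z x) :
    ocw (G.ValidZone a b c O Z) (G.G1Z a b c O Z) (G.G2Z a b c O Z) x =
      (G.zoneFZ a b O Z).ocWeight (G.zoneA a b c O Z) (G.toStZ a b Z x) := by
  have hsub := blueSub_extZone_of_chords hx.1
  have hadm : ¬ G.Conn (G.extZone a b O Z x)ᶜ a b := (adm_extZone hc hne hZ hx).2.2
  have e0 : ZoneOCube.ind (G.ValidZone a b c O Z x) =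
      ZoneOCube.ind ((G.zoneFZ a b O Z).Valid (G.zoneA a b c O Z) (G.toStZ a b Z x)) :=
    ind_congr (zone_valid_iff hc O hZ x).symm
  have e1 : ZoneOCube.ind (G.G1Z a b c O Z x) =
      ZoneOCube.ind ((G.zoneFZ a b O Z).G1 (G.zoneA a b c O Z) (G.toStZ a b Z x)) :=
    ind_congr (zone_G1_iff hc O hZ x hsub hadm).symm
  have e2 : ZoneOCube.ind (G.G2Z a b c O Z x) =
      ZoneOCube.ind ((G.zoneFZ a b O Z).G2 (G.zoneA a b c O Z) (G.toStZ a b Z x)) :=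
    ind_congr (zone_G2_iff hc O hZ x hsub hadm).symm
  rw [ocw_eq (fun _ h => validZone_of_G1Z h) (fun _ h => validZone_of_G2Z h), ocWeight_eq, e0, e1, e2]
  rfl

open Classical in
/-- The per-zone weighted sum over the admissible zone-states is the ZONE O-CUBE sum of the zone with forced edges. -/
theorem sum_zone_ocw_eq_zoneOCubeF (Z : G.ZoneIdx a b c O) :
    ∑ x : G.AZ O Z, ocw (fun x : G.AZ O Z => G.ValidZone a b c O Z.1 x.1) (fun x => G.G1Z a b c O Z.1 x.1)
      (fun x => G.G2Z a b c O Z.1 x.1) x =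
      (G.zoneFZ a b O Z.1).zoneOCubeF (G.zoneA a b c O Z.1) (zoneQ c Z.1) := by
  have hZnt : ∀ v ∈ Z.1, v ≠ a ∧ v ≠ b := fun v hv => ne_terminal_of_mem_idxZone hc Z.2 hv
  unfold FZone.zoneOCubeF
  refine Finset.sum_bij' (fun x _ => G.toStZ a b Z.1 x.1) (fun σ hσ => ⟨G.ofStZ a b Z.1 σ, ?_⟩) ?_ ?_ ?_ ?_ ?_
  · unfold FZone.AsetF at hσ
    rw [Finset.mem_filter] at hσ
    rw [zone_admZone_iff hc O Z.2, toStZ_ofStZ hne hZnt σ]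
    exact hσ.2
  · intro x _
    unfold FZone.AsetF
    rw [Finset.mem_filter]
    exact ⟨Finset.mem_univ _, (zone_admZone_iff hc O Z.2 x.1).1 x.2⟩
  · intro σ _
    exact Finset.mem_univ _
  · intro x _
    exact Subtype.ext (ofStZ_toStZ Z.1 x.1)
  · intro σ _
    exact toStZ_ofStZ hne hZnt σ
  · intro x _
    exact ocw_eq_ocWeight_zone hc hne Z.2 x.1 x.2

open Classical in
/-- The O-cube sum of a tail-free hub core is `|OutT|` times the product sum of the per-zone weights. -/
theorem oCube_eq_card_mul_sum (hab : ∃ e, G.Joins e a b) (hO : G.TailFree a b c O) (hhub : G.HubCore a b c O) :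
    G.oCube a b c O = (Fintype.card (G.OutT a b c O) : ℤ) *
      ∑ x : ∀ Z : G.ZoneIdx a b c O, G.AZ O Z,
        ocwPi' (S := fun Z : G.ZoneIdx a b c O => G.AZ O Z) (fun Z x => G.ValidZone a b c O Z.1 x.1)
          (fun Z x => G.G1Z a b c O Z.1 x.1) (fun Z x => G.G2Z a b c O Z.1 x.1) x := by
  rw [oCube_eq_sum_valid_cube O, Finset.sum_filter]
  have h1 : ∀ S ∈ G.cubeStateSet a b c O, (if ¬ G.RcInvalid a b c S then G.gdWeight a b c S else 0) =
      ocwPi' (S := fun Z : G.ZoneIdx a b c O => G.ZoneState a b Z.1) (fun Z => G.ValidZone a b c O Z.1)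
        (fun Z => G.G1Z a b c O Z.1) (fun Z => G.G2Z a b c O Z.1) (fun Z => G.restrictZone a b Z.1 S) := by
    intro S hS
    unfold cubeStateSet at hS
    rw [Finset.mem_filter] at hS
    rw [← gdWeight_eq_ocwPi hc hne hab hO hhub hS.2]
    by_cases hv : G.RcInvalid a b c S
    · rw [if_neg (not_not.2 hv)]
      unfold ocw
      rw [ind_of_false (not_not.2 hv)]
      ring
    · rw [if_pos hv, gdWeight_eq_ocw hv]
  rw [Finset.sum_congr rfl h1]
  have h2 : ∑ S ∈ G.cubeStateSet a b c O,
      ocwPi' (S := fun Z : G.ZoneIdx a b c O => G.ZoneState a b Z.1) (fun Z => G.ValidZone a b c O Z.1)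
        (fun Z => G.G1Z a b c O Z.1) (fun Z => G.G2Z a b c O Z.1) (fun Z => G.restrictZone a b Z.1 S) =
      ∑ p : (∀ Z : G.ZoneIdx a b c O, G.AZ O Z) × G.OutT a b c O,
        ocwPi' (S := fun Z : G.ZoneIdx a b c O => G.AZ O Z) (fun Z x => G.ValidZone a b c O Z.1 x.1)
          (fun Z x => G.G1Z a b c O Z.1 x.1) (fun Z x => G.G2Z a b c O Z.1 x.1) p.1 := by
    refine Finset.sum_bij' (fun S hS => cubeEquiv hc hne ⟨S, by
        unfold cubeStateSet at hS
        rw [Finset.mem_filter] at hS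
        exact hS.2⟩) (fun p _ => ((cubeEquiv hc hne).symm p).1) (fun _ _ => Finset.mem_univ _) ?_ ?_ ?_ ?_
    · intro p _
      unfold cubeStateSet
      rw [Finset.mem_filter]
      exact ⟨Finset.mem_univ _, ((cubeEquiv hc hne).symm p).2⟩
    · intro S hS
      rw [Equiv.symm_apply_apply]
    · intro p _
      change cubeEquiv hc hne ⟨((cubeEquiv hc hne).symm p).1, _⟩ = p
      exact Equiv.apply_symm_apply (cubeEquiv hc hne) p
    · intro S _
      rfl
  rw [h2, Fintype.sum_prod_type]
  simp only [Finset.sum_const, Finset.card_univ, nsmul_eq_mul]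
  rw [Finset.mul_sum]

open Classical in
/-- **(O-CUBE) ON HUB CORES FROM THE ZONE O-CUBE** (C-041.md §14 (c)): for a tail-free hub core `O`, if every indexed
zone satisfies the ZONE O-CUBE conjecture (on its zone with forced edges, with its anchors and the protected anchor
`{c} ∩ Z`), then the O-cube sum of `O` is nonnegative. -/
theorem oCube_nonneg_of_zoneOCube_hub (hab : ∃ e, G.Joins e a b) (hO : G.TailFree a b c O)
    (hhub : G.HubCore a b c O)
    (hzone : ∀ Z : G.ZoneIdx a b c O, (G.zoneFZ a b O Z.1).ZoneOCubeConjF (G.zoneA a b c O Z.1) (zoneQ c Z.1)) :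
    0 ≤ G.oCube a b c O := by
  rw [oCube_eq_card_mul_sum hc hne hab hO hhub]
  refine mul_nonneg (by positivity) ?_
  refine union_lemma_fintype (S := fun Z : G.ZoneIdx a b c O => G.AZ O Z)
    (fun Z x => G.ValidZone a b c O Z.1 x.1) (fun Z x => G.G1Z a b c O Z.1 x.1) (fun Z x => G.G2Z a b c O Z.1 x.1)
    (fun _ _ h => validZone_of_G1Z h) (fun _ _ h => validZone_of_G2Z h) fun Z => ?_
  rw [sum_zone_ocw_eq_zoneOCubeF hc hne Z]
  exact hzone Z

end Sum

end MultiGraph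

end PercRepro
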